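import Summits.QuantumFields.YangMills.Theorems.BalabanUVNodesN19RieszProductLaws
import Summits.QuantumFields.YangMills.Theorems.BalabanUVNodesN19LawSummabilityThresholdExamples

/-!
# N19 (NE7, s3 ALTERNATIVE CURRENCY) — THE LAW-SUMMABILITY THRESHOLD OF THE WINDOW CURRENCY IS EXACT FOR ALL POSITIVE REMAINDERS

Module 102 of the `dag-n19-e` lineage; settles CURRENCY-MAP v4's oldest open item (y).  Module 75 (p593554
`summable_lawIncrements_iff_summable_logRate`) proved: for an ANTITONE remainder `δ > 0`,
`Σ_K r(log⁺(vol·δ_K)⁻¹) < ∞` (`r(L) = log(e+L)∕(1+L)`) IFF every sequence of probability laws `λ_K` on `[−1,1]` with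
`MatchingModConstants vol l₀ δ (K t ↦ mgf λ_K t)` has summable bounded-Lipschitz increments — and left the NON-monotone
case open («isolated large budgets between tiny ones interact»; the arc chains of modules 72–77 are path-limited, and
CURRENCY-MAP v2's «scaled ruler» budgets defeat every path functional of module 77).

★★★ `exists_matchingModConstants_not_summable_lawIncrements_of_pos`: for EVERY `l₀ > 0`, `vol > 0` and EVERY
`δ > 0` — no monotonicity — with `Σ_K r_K = ∞` there are probability laws `λ_K` on `[−1,1]` with
`MatchingModConstants vol l₀ δ (K t ↦ mgf λ_K t)` (constants `0`) and continuous tests `g_K`, `1`-Lipschitz and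
`1`-bounded on `[−1,1]`, with `Σ_K |∫g_K dλ_{K+1} − ∫g_K dλ_K| = ∞`.  Hence ★★★
`summable_lawIncrements_iff_summable_logRate_of_pos`: THE THRESHOLD IS EXACT FOR EVERY POSITIVE REMAINDER, and ★
`exists_target_not_summable_lawIncrements_of_pos`: N19's DECL target `Spine.NE7.Target vol l₀ δ` with ANY summable
`δ > 0` whose rates diverge admits string laws with non-summable increments.

THE SEQUENCE — RIESZ-PRODUCT LAWS, INDEPENDENT TOGGLES (module 101).  Levels `e = e₀ + i` (`e₀ = ⌈l₀⌉`, so that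
`2l₀ ≤ 6·8^e + 2`), frequencies `8^{e+1}`; the law of step `K` is `λ_{A_K}`, the law of `cos φ` under
`(1∕π)∏_{e∈A_K}(1 + cos(8^{e+1}φ))dφ`, where `A_0 = ∅` and `A_{K+1} = A_K △ {e(K)}` TOGGLES the level
`e(K) = e₀ + i(K)`, `i(K)` THE LEAST index whose window price `cost(i) = 2e^{l₀}·l₀^{6·8^{e₀+i}+1}∕(6·8^{e₀+i}+1)!` fits
`vol·δ_K` (`Nat.find`; the price is super-geometric, module 73).  By module 101 every toggle is affordable
(`|Δcgf| ≤ cost(i(K)) ≤ vol·δ_K` on `|t| ≤ l₀`, WHATEVER the other active levels) and is paid EXACTLY `1∕(16·8^{e(K)+1})`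
by the `1`-Lipschitz test `(1−x²)T_n(x)∕(4n)`, `n = 8^{e(K)+1}`.  THE INVERSION (module 75
`logRate_le_div_of_lt_stepCost` at the minimal index): if `i(K) ≥ 1` then `vol·δ_K < cost(i(K)−1)`, so for exponents
past `K₀(l₀)` the rate is `r_K ≤ 12∕k`, `k = 6·8^{e(K)−1}+1`, i.e. `≤ 2048·payment`; small levels pay at least a fixed
`κ(l₀) ≥ κ·r_K`.  So `κ·r_K ≤ payment_K` for EVERY `K` — no parity, no monotonicity, no path: summable increments would
make `Σ r_K` finite.

HONEST FRAMING (binding).  Elementary and [folklore] (Riesz products; Stirling) over Mathlib + the lineage BY NAME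
(modules 73 ∕ 74 ∕ 75 ∕ 76 ∕ 101); TOY laws `Z_K = mgf λ_K`, no scheme object, no Theses import; a structural statement
about the SHAPE `MatchingModConstants ∧ Summable δ` of N19's DECL target; NO consumer in the DAG today; nothing of
Bałaban's instantiated; NE7 NOT PRINTED, NOT proved; N19 NOT discharged; count-neutral.  One finite `T⁴` programme
at fixed `ε`; nothing continuum ∕ `ℝ⁴` ∕ OS ∕ mass-gap ∕ Clay.  0 `def` ∕ 0 `sorry`.
-/

noncomputable section

open Real Finset MeasureTheory ProbabilityTheory Polynomial Polynomial.Chebyshev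

namespace Summit.QuantumFields.YangMills.Theorems.BalabanUVNodesN19LawSummabilityThresholdExact

open Literature.MathematicalPhysics.QuantumFieldTheory.Balaban1983to89
open T4CauchySum (MatchingModConstants)
open Summit.QuantumFields.BalabanUV.T4Continuum.Spine
open BalabanUVNodesN19RieszProductLaws
open BalabanUVNodesN19TargetNotLawSummableSharp (pow_div_factorial_le_exp_mul_pow)
open BalabanUVNodesN19LawSummabilityThreshold (logRate_le_one logRate_pos summable_lawIncrements_of_matchingModConstants)
open BalabanUVNodesN19LawSummabilityThresholdSharp (logRate_le_div_of_lt_stepCost)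
open BalabanUVNodesN19LawSummabilityThresholdExamples (not_summable_logRate_of_geometric_le)

/-! ## §1 The Riesz-product sequence at the level of the budget [folklore] -/

/-- ★★★ **THE LOWER HALF OF THE THRESHOLD, FOR EVERY POSITIVE REMAINDER.**  For every `l₀ > 0`, `vol > 0` and every
`δ > 0` (NO monotonicity) whose rates `r(log⁺(vol·δ_K)⁻¹)` (`r(L) = log(e+L)∕(1+L)`) are NOT summable, there are
probability laws `λ_K` on `[−1,1]` with `MatchingModConstants vol l₀ δ (K t ↦ mgf λ_K t)` (matching modulo the
constants `0`) and continuous test functions `g_K`, `1`-Lipschitz and `1`-bounded on `[−1,1]`, whose bounded-Lipschitz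
increments `|∫g_K dλ_{K+1} − ∫g_K dλ_K|` are NOT summable (the Riesz-product toggles at the level of the budget,
header). [folklore] -/
theorem exists_matchingModConstants_not_summable_lawIncrements_of_pos {l₀ vol : ℝ} (hl₀ : 0 < l₀) (hvol : 0 < vol)
    {δ : ℕ → ℝ} (hδ : ∀ K, 0 < δ K)
    (hS : ¬ Summable fun K => Real.log (Real.exp 1 + Real.posLog (vol * δ K)⁻¹) / (1 + Real.posLog (vol * δ K)⁻¹)) :
    ∃ Λ : ℕ → Measure ℝ, (∀ K, IsProbabilityMeasure (Λ K)) ∧ (∀ K, Λ K (Set.Icc (-1 : ℝ) 1)ᶜ = 0) ∧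
      MatchingModConstants vol l₀ δ (fun K t => mgf id (Λ K) t) ∧
      ∃ g : ℕ → ℝ → ℝ, (∀ K, Continuous (g K)) ∧
        (∀ (K : ℕ) (x y : ℝ), x ∈ Set.Icc (-1 : ℝ) 1 → y ∈ Set.Icc (-1 : ℝ) 1 → |g K x - g K y| ≤ 1 * |x - y|) ∧
        (∀ (K : ℕ) (x : ℝ), x ∈ Set.Icc (-1 : ℝ) 1 → |g K x| ≤ 1) ∧
        ¬ Summable (fun K => |∫ x, g K x ∂Λ (K + 1) - ∫ x, g K x ∂Λ K|) := by
  classical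
  -- the Riesz-product laws at scale `1`
  obtain ⟨Λ, hP, hsupp, -, hform⟩ := exists_rieszLaws (c := (1 : ℝ)) (by norm_num)
  haveI : ∀ A, IsProbabilityMeasure (Λ A) := hP
  -- the base level `e₀ = ⌈l₀⌉`: every used level `e ≥ e₀` has `2l₀ ≤ 6·8^e + 2`
  set e₀ : ℕ := ⌈l₀⌉₊ with he₀
  have hlev : ∀ i : ℕ, 2 * l₀ ≤ 6 * (8 : ℝ) ^ (e₀ + i) + 2 := by
    intro i
    have h1 : (e₀ : ℝ) < (8 : ℝ) ^ e₀ := by exact_mod_cast Nat.lt_pow_self (by norm_num : 1 < 8)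
    have h2 : (8 : ℝ) ^ e₀ ≤ 8 ^ (e₀ + i) := pow_le_pow_right₀ (by norm_num) (by omega)
    have h3 : l₀ ≤ e₀ := Nat.le_ceil _
    linarith
  -- the window price of a level and its super-geometric decay
  set cost : ℕ → ℝ := fun i =>
    Real.exp l₀ * (2 * (l₀ ^ (6 * 8 ^ (e₀ + i) + 1) / ((6 * 8 ^ (e₀ + i) + 1).factorial : ℝ))) with hcost
  have hcost_small : ∀ x : ℝ, 0 < x → ∃ i : ℕ, cost i ≤ x := by
    intro x hx
    set C : ℝ := Real.exp l₀ * (2 * Real.exp (l₀ / (1 / 2) ^ 2)) with hC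
    have hC0 : 0 < C := by positivity
    obtain ⟨i, hi⟩ := exists_pow_lt_of_lt_one (div_pos hx hC0) (by norm_num : (1 / 2 : ℝ) < 1)
    refine ⟨i, ?_⟩
    set m : ℕ := 6 * 8 ^ (e₀ + i) + 1 with hm
    have h := pow_div_factorial_le_exp_mul_pow hl₀.le (by norm_num : (0 : ℝ) < 1 / 2) m
    have him : i ≤ 2 * m := by
      have : e₀ + i < 8 ^ (e₀ + i) := Nat.lt_pow_self (by norm_num)
      omega
    have hpow : (1 / 2 : ℝ) ^ (2 * m) ≤ (1 / 2 : ℝ) ^ i := pow_le_pow_of_le_one (by norm_num) (by norm_num) him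
    calc cost i = Real.exp l₀ * (2 * (l₀ ^ m / (m.factorial : ℝ))) := by simp only [hcost, hm]
      _ ≤ Real.exp l₀ * (2 * (Real.exp (l₀ / (1 / 2) ^ 2) * (1 / 2 : ℝ) ^ i)) := by
          gcongr
          exact h.trans (mul_le_mul_of_nonneg_left hpow (by positivity))
      _ = C * (1 / 2 : ℝ) ^ i := by rw [hC]; ring
      _ ≤ C * (x / C) := mul_le_mul_of_nonneg_left hi.le hC0.le
      _ = x := by field_simp
  -- THE LEVEL OF THE BUDGET: `ix K` = the least index whose price fits `vol·δ_K`
  have hex : ∀ K : ℕ, ∃ i : ℕ, cost i ≤ vol * δ K := fun K => hcost_small _ (mul_pos hvol (hδ K))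
  let ix : ℕ → ℕ := fun K => Nat.find (hex K)
  have hix_spec : ∀ K, cost (ix K) ≤ vol * δ K := fun K => Nat.find_spec (hex K)
  have hix_min : ∀ K j, j < ix K → vol * δ K < cost j := fun K j hj => not_le.1 (Nat.find_min (hex K) hj)
  -- the set of active levels: `A_0 = ∅`, `A_{K+1} = A_K △ {e₀ + ix K}`
  obtain ⟨A, -, hA⟩ : ∃ A : ℕ → Finset ℕ, A 0 = ∅ ∧
      ∀ K, A (K + 1) = if e₀ + ix K ∈ A K then (A K).erase (e₀ + ix K) else insert (e₀ + ix K) (A K) :=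
    ⟨fun K => Nat.rec (motive := fun _ => Finset ℕ) ∅
      (fun K S => if e₀ + ix K ∈ S then S.erase (e₀ + ix K) else insert (e₀ + ix K) S) K, rfl, fun K => rfl⟩
  -- every step is ONE toggle of the level `e₀ + ix K` against a set not containing it
  have htog : ∀ K, ∃ B : Finset ℕ, e₀ + ix K ∉ B ∧
      ((A (K + 1) = insert (e₀ + ix K) B ∧ A K = B) ∨ (A (K + 1) = B ∧ A K = insert (e₀ + ix K) B)) := by
    intro K
    by_cases h : e₀ + ix K ∈ A K
    · refine ⟨(A K).erase (e₀ + ix K), Finset.notMem_erase _ _, Or.inr ⟨by rw [hA K, if_pos h], ?_⟩⟩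
      exact (Finset.insert_erase h).symm
    · exact ⟨A K, h, Or.inl ⟨by rw [hA K, if_neg h], rfl⟩⟩
  -- the tests: `g_K = (1 − x²)T_n(x)∕(4n)`, `n = 8^{e₀ + ix K + 1}`
  set g : ℕ → ℝ → ℝ := fun K x => (1 - x ^ 2) * (T ℝ ((8 ^ (e₀ + ix K + 1) : ℕ) : ℤ)).eval x /
    (4 * ((8 ^ (e₀ + ix K + 1) : ℕ) : ℝ)) with hg
  have hn1 : ∀ K, 1 ≤ 8 ^ (e₀ + ix K + 1) := fun K => Nat.one_le_pow _ _ (by norm_num)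
  -- the payment of step `K` is exactly `1∕(16·8^{e₀+ix K+1})`
  have hpay : ∀ K, |∫ x, g K x ∂Λ (A (K + 1)) - ∫ x, g K x ∂Λ (A K)| = 1 / (16 * ((8 ^ (e₀ + ix K + 1) : ℕ) : ℝ)) := by
    intro K
    obtain ⟨B, hB, h⟩ := htog K
    have key := integral_rieszTest_toggle_sub hform hB
    rcases h with ⟨h1, h2⟩ | ⟨h1, h2⟩
    · rw [h1, h2]; simp only [hg]; rw [key]; exact abs_of_pos (by positivity)
    · rw [h1, h2, abs_sub_comm]; simp only [hg]; rw [key]; exact abs_of_pos (by positivity)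
  -- the window price of step `K` is at most `cost (ix K) ≤ vol·δ_K`
  have hcgf : ∀ (K : ℕ) (t : ℝ), |t| ≤ l₀ → |cgf id (Λ (A (K + 1))) t - cgf id (Λ (A K)) t| ≤ cost (ix K) := by
    intro K t ht
    obtain ⟨B, hB, h⟩ := htog K
    have key := abs_cgf_toggle_sub_le hsupp (c := (1 : ℝ)) (by norm_num) hform hB
      (l₀ := l₀) (t := t) (by exact_mod_cast hlev (ix K)) ht
    rcases h with ⟨h1, h2⟩ | ⟨h1, h2⟩
    · rw [h1, h2]; exact key
    · rw [h1, h2, abs_sub_comm]; exact key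
  refine ⟨fun K => Λ (A K), fun K => hP _, fun K => hsupp _, fun K => ⟨0, fun t ht => ?_⟩, g,
    fun K => ((continuous_const.sub (continuous_pow 2)).mul (Polynomial.continuous _)).div_const _,
    fun K x y hx hy => (rieszTest_lipschitz_bound (hn1 K)).1 x y hx hy,
    fun K x hx => ((rieszTest_lipschitz_bound (hn1 K)).2 x hx).trans ?_, fun hSum => ?_⟩
  · -- matching modulo the constants `0`
    rw [sub_zero]
    exact (hcgf K t ht).trans (hix_spec K)
  · -- `1∕(4n) ≤ 1`
    rw [div_le_one (by positivity)]
    have : (1 : ℝ) ≤ ((8 ^ (e₀ + ix K + 1) : ℕ) : ℝ) := by exact_mod_cast hn1 K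
    linarith
  · -- NOT SUMMABLE: every step pays at least `κ·r_K`
    set r : ℕ → ℝ := fun K => Real.log (Real.exp 1 + Real.posLog (vol * δ K)⁻¹) / (1 + Real.posLog (vol * δ K)⁻¹)
      with hrdef
    have hr0 : ∀ K, 0 ≤ r K := fun K => (logRate_pos Real.posLog_nonneg).le
    have hr1 : ∀ K, r K ≤ 1 := fun K => logRate_le_one Real.posLog_nonneg
    -- the explicit threshold `K₀(l₀)` of module 75's inversion lemma and the constant `κ`
    set K₀ : ℕ := max ⌈8 * l₀ + 12⌉₊ ⌈Real.exp (2 * (1 + Real.log l₀))⌉₊ with hK₀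
    set κ : ℝ := 1 / (2048 + 16 * ((8 : ℝ) ^ (e₀ + 1) + 11 * K₀)) with hκ
    have hκ0 : 0 < κ := by positivity
    have hden : (2048 : ℝ) ≤ 2048 + 16 * ((8 : ℝ) ^ (e₀ + 1) + 11 * K₀) := by
      have : (0 : ℝ) ≤ 16 * ((8 : ℝ) ^ (e₀ + 1) + 11 * K₀) := by positivity
      linarith
    have hκ1 : κ ≤ 1 / 2048 := one_div_le_one_div_of_le (by norm_num) hden
    have hκ2 : ∀ n : ℝ, 0 < n → n ≤ (8 : ℝ) ^ (e₀ + 1) + 11 * K₀ → κ ≤ 1 / (16 * n) := fun n hn hle =>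
      one_div_le_one_div_of_le (by positivity) (by nlinarith)
    have hkey : ∀ K : ℕ, κ * r K ≤ 1 / (16 * ((8 ^ (e₀ + ix K + 1) : ℕ) : ℝ)) := by
      intro K
      have hcast : ((8 ^ (e₀ + ix K + 1) : ℕ) : ℝ) = (8 : ℝ) ^ (e₀ + ix K + 1) := by push_cast; ring
      rw [hcast]
      rcases Nat.eq_zero_or_pos (ix K) with h0 | hpos
      · -- the cheapest level: pay at least `1∕(16·8^{e₀+1}) ≥ κ ≥ κ·r`
        rw [h0, add_zero]
        refine (mul_le_of_le_one_right hκ0.le (hr1 K)).trans (hκ2 _ (by positivity) ?_)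
        have : (0 : ℝ) ≤ 11 * K₀ := by positivity
        linarith
      · obtain ⟨j, hj⟩ : ∃ j, ix K = j + 1 := ⟨ix K - 1, by omega⟩
        rw [hj]
        set k : ℕ := 6 * 8 ^ (e₀ + j) + 1 with hk
        have hlt0 := hix_min K j (by omega)
        by_cases hkK : K₀ ≤ k
        · -- large level: module 75's inversion lemma at the minimal index
          have hk_ge1 : (⌈8 * l₀ + 12⌉₊ : ℝ) ≤ k := by exact_mod_cast (le_max_left _ _).trans hkK
          have hk_ge2 : (⌈Real.exp (2 * (1 + Real.log l₀))⌉₊ : ℝ) ≤ k := by exact_mod_cast (le_max_right _ _).trans hkK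
          have hkb : 8 * l₀ + 12 ≤ (k : ℝ) := (Nat.le_ceil _).trans hk_ge1
          have hk4 : 4 ≤ k := by
            have : (4 : ℝ) ≤ k := by linarith
            exact_mod_cast this
          have hkpos : (0 : ℝ) < k := by linarith
          have hka : 2 * (1 + Real.log l₀) ≤ Real.log k := by
            rw [Real.le_log_iff_exp_le hkpos]
            exact (Nat.le_ceil _).trans hk_ge2
          have hlt : vol * δ K < 4 * Real.exp l₀ * (l₀ ^ k / (k.factorial : ℝ)) := by
            refine hlt0.trans_le ?_
            simp only [hcost, ← hk]
            have : 0 ≤ Real.exp l₀ * (l₀ ^ k / (k.factorial : ℝ)) := by positivity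
            nlinarith
          have hrate : r K ≤ 12 / k := logRate_le_div_of_lt_stepCost hl₀ (mul_pos hvol (hδ _)) hk4 hka hkb hlt
          have hkr : (k : ℝ) = 6 * 8 ^ (e₀ + j) + 1 := by rw [hk]; push_cast; ring
          have h8 : (8 : ℝ) ^ (e₀ + (j + 1) + 1) = 64 * 8 ^ (e₀ + j) := by ring
          have hP0 : (0 : ℝ) < 8 ^ (e₀ + j) := by positivity
          calc κ * r K ≤ (1 / 2048) * (12 / k) := mul_le_mul hκ1 hrate (hr0 _) (by norm_num)
            _ ≤ 1 / (16 * (8 : ℝ) ^ (e₀ + (j + 1) + 1)) := by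
                rw [hkr, h8, div_mul_div_comm, div_le_div_iff₀ (by positivity) (by positivity)]
                nlinarith
        · -- small level: the frequency is below `11K₀`, pay at least `κ`
          rw [not_le] at hkK
          have hkK' : (6 * 8 ^ (e₀ + j) + 1 : ℝ) < K₀ := by rw [hk] at hkK; exact_mod_cast hkK
          refine (mul_le_of_le_one_right hκ0.le (hr1 K)).trans (hκ2 _ (by positivity) ?_)
          have h8 : (8 : ℝ) ^ (e₀ + (j + 1) + 1) = 64 * 8 ^ (e₀ + j) := by ring
          have : (0 : ℝ) ≤ (8 : ℝ) ^ (e₀ + 1) := by positivity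
          rw [h8]; nlinarith
    -- comparison: summable payments ⇒ summable rates — contradiction
    have hpay' : ∀ K, |∫ x, g K x ∂Λ (A (K + 1)) - ∫ x, g K x ∂Λ (A K)| = 1 / (16 * ((8 ^ (e₀ + ix K + 1) : ℕ) : ℝ)) :=
      hpay
    simp_rw [hpay'] at hSum
    have hκr : Summable (fun K => κ * r K) :=
      Summable.of_nonneg_of_le (fun K => mul_nonneg hκ0.le (hr0 K)) hkey hSum
    exact hS ((summable_mul_left_iff hκ0.ne').1 hκr)

/-- ★ **IN N19's DECL-TARGET SHAPE.**  If moreover `Σδ < ∞`, the family of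
`exists_matchingModConstants_not_summable_lawIncrements_of_pos` satisfies `Spine.NE7.Target vol l₀ δ (K t ↦ mgf λ_K t)`
itself: N19's DECL target with ANY summable remainder whose rates diverge — monotone or not — does NOT control the
bounded-Lipschitz increments of the laws summably. [folklore] -/
theorem exists_target_not_summable_lawIncrements_of_pos {l₀ vol : ℝ} (hl₀ : 0 < l₀) (hvol : 0 < vol) {δ : ℕ → ℝ}
    (hδ : ∀ K, 0 < δ K) (hsum : Summable δ)
    (hS : ¬ Summable fun K => Real.log (Real.exp 1 + Real.posLog (vol * δ K)⁻¹) / (1 + Real.posLog (vol * δ K)⁻¹)) :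
    ∃ Λ : ℕ → Measure ℝ, (∀ K, IsProbabilityMeasure (Λ K)) ∧ (∀ K, Λ K (Set.Icc (-1 : ℝ) 1)ᶜ = 0) ∧
      NE7.Target vol l₀ δ (fun K t => mgf id (Λ K) t) ∧
      ∃ g : ℕ → ℝ → ℝ, (∀ K, Continuous (g K)) ∧
        (∀ (K : ℕ) (x y : ℝ), x ∈ Set.Icc (-1 : ℝ) 1 → y ∈ Set.Icc (-1 : ℝ) 1 → |g K x - g K y| ≤ 1 * |x - y|) ∧
        (∀ (K : ℕ) (x : ℝ), x ∈ Set.Icc (-1 : ℝ) 1 → |g K x| ≤ 1) ∧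
        ¬ Summable (fun K => |∫ x, g K x ∂Λ (K + 1) - ∫ x, g K x ∂Λ K|) := by
  obtain ⟨Λ, hP, hc, hM, g, hg⟩ := exists_matchingModConstants_not_summable_lawIncrements_of_pos hl₀ hvol hδ hS
  exact ⟨Λ, hP, hc, ⟨hM, hsum⟩, g, hg⟩

/-! ## §2 The exact threshold for every positive remainder [folklore] -/

/-- ★★★ **THE EXACT LAW-SUMMABILITY THRESHOLD OF THE WINDOW CURRENCY — ALL POSITIVE REMAINDERS.**  For `l₀ > 0`,
`vol > 0` and ANY `δ > 0`: `Σ_K r(log⁺(vol·δ_K)⁻¹) < ∞` (`r(L) = log(e+L)∕(1+L)`) IF AND ONLY IF every sequence of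
probability laws `λ_K` on `[−1,1]` with `MatchingModConstants vol l₀ δ (K t ↦ mgf λ_K t)` has summable increments
`|∫g_K dλ_{K+1} − ∫g_K dλ_K|` along every sequence of continuous tests `g_K`, `1`-Lipschitz and `1`-bounded on
`[−1,1]`.  (⇒ module 74 `summable_lawIncrements_of_matchingModConstants`; ⇐ §1.  Module 75's
`summable_lawIncrements_iff_summable_logRate` is the antitone case.) [folklore] -/
theorem summable_lawIncrements_iff_summable_logRate_of_pos {l₀ vol : ℝ} (hl₀ : 0 < l₀) (hvol : 0 < vol) {δ : ℕ → ℝ}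
    (hδ : ∀ K, 0 < δ K) :
    (Summable fun K => Real.log (Real.exp 1 + Real.posLog (vol * δ K)⁻¹) / (1 + Real.posLog (vol * δ K)⁻¹)) ↔
      ∀ Λ : ℕ → Measure ℝ, (∀ K, IsProbabilityMeasure (Λ K)) → (∀ K, Λ K (Set.Icc (-1 : ℝ) 1)ᶜ = 0) →
        MatchingModConstants vol l₀ δ (fun K t => mgf id (Λ K) t) →
        ∀ g : ℕ → ℝ → ℝ, (∀ K, Continuous (g K)) →
          (∀ (K : ℕ) (x y : ℝ), x ∈ Set.Icc (-1 : ℝ) 1 → y ∈ Set.Icc (-1 : ℝ) 1 → |g K x - g K y| ≤ 1 * |x - y|) →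
          (∀ (K : ℕ) (x : ℝ), x ∈ Set.Icc (-1 : ℝ) 1 → |g K x| ≤ 1) →
          Summable fun K => |∫ x, g K x ∂Λ (K + 1) - ∫ x, g K x ∂Λ K| := by
  refine ⟨fun hS Λ hP hc hM g _ hL hB => ?_, fun h => ?_⟩
  · haveI := hP
    exact summable_lawIncrements_of_matchingModConstants hc hl₀ hM hS zero_le_one hL hB
  · by_contra hS
    obtain ⟨Λ, hP, hc, hM, g, hgc, hL, hB, hns⟩ :=
      exists_matchingModConstants_not_summable_lawIncrements_of_pos hl₀ hvol hδ hS
    exact hns (h Λ hP hc hM g hgc hL hB)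

/-- ★ **AND FOR N19's DECL TARGET**: for `l₀ > 0`, `vol > 0` and ANY summable `δ > 0`, every `Spine.NE7.Target vol l₀ δ`
sequence of string laws on `[−1,1]` has summable bounded-Lipschitz increments iff `Σ_K r(log⁺(vol·δ_K)⁻¹) < ∞`; in
particular (module 76) NEVER when `δ` is bounded below by a geometric sequence. [folklore] -/
theorem summable_lawIncrements_of_target_iff_summable_logRate_of_pos {l₀ vol : ℝ} (hl₀ : 0 < l₀) (hvol : 0 < vol)
    {δ : ℕ → ℝ} (hδ : ∀ K, 0 < δ K) (hsum : Summable δ) :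
    (Summable fun K => Real.log (Real.exp 1 + Real.posLog (vol * δ K)⁻¹) / (1 + Real.posLog (vol * δ K)⁻¹)) ↔
      ∀ Λ : ℕ → Measure ℝ, (∀ K, IsProbabilityMeasure (Λ K)) → (∀ K, Λ K (Set.Icc (-1 : ℝ) 1)ᶜ = 0) →
        NE7.Target vol l₀ δ (fun K t => mgf id (Λ K) t) →
        ∀ g : ℕ → ℝ → ℝ, (∀ K, Continuous (g K)) →
          (∀ (K : ℕ) (x y : ℝ), x ∈ Set.Icc (-1 : ℝ) 1 → y ∈ Set.Icc (-1 : ℝ) 1 → |g K x - g K y| ≤ 1 * |x - y|) →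
          (∀ (K : ℕ) (x : ℝ), x ∈ Set.Icc (-1 : ℝ) 1 → |g K x| ≤ 1) →
          Summable fun K => |∫ x, g K x ∂Λ (K + 1) - ∫ x, g K x ∂Λ K| := by
  rw [summable_lawIncrements_iff_summable_logRate_of_pos hl₀ hvol hδ]
  refine ⟨fun h Λ hP hc hT => h Λ hP hc hT.1, fun h Λ hP hc hM => h Λ hP hc ⟨hM, hsum⟩⟩

/-! ## §3 The programme's remainders: geometric lower bounds, no monotonicity [folklore] -/

/-- ★★ **N19's DECL TARGET WITH ANY SUMMABLE REMAINDER BOUNDED BELOW GEOMETRICALLY — MONOTONE OR NOT — ADMITS STRING LAWS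
WITH NON-SUMMABLE INCREMENTS**: `Cθ^K ≤ δ_K`, `Σδ < ∞` (`C, θ, vol, l₀ > 0`) ⇒ laws `λ_K` on `[−1,1]` with
`Spine.NE7.Target vol l₀ δ (K t ↦ mgf λ_K t)` and continuous `1`-Lipschitz `1`-bounded tests with
`Σ_K |∫g_K dλ_{K+1} − ∫g_K dλ_K| = ∞` (module 76's instance without its `Antitone δ`). [folklore] -/
theorem exists_target_not_summable_lawIncrements_of_geometric_le_of_pos {l₀ vol C θ : ℝ} {δ : ℕ → ℝ} (hl₀ : 0 < l₀)
    (hvol : 0 < vol) (hC : 0 < C) (hθ : 0 < θ) (hle : ∀ K : ℕ, C * θ ^ K ≤ δ K) (hsum : Summable δ) :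
    ∃ Λ : ℕ → Measure ℝ, (∀ K, IsProbabilityMeasure (Λ K)) ∧ (∀ K, Λ K (Set.Icc (-1 : ℝ) 1)ᶜ = 0) ∧
      NE7.Target vol l₀ δ (fun K t => mgf id (Λ K) t) ∧
      ∃ g : ℕ → ℝ → ℝ, (∀ K, Continuous (g K)) ∧
        (∀ (K : ℕ) (x y : ℝ), x ∈ Set.Icc (-1 : ℝ) 1 → y ∈ Set.Icc (-1 : ℝ) 1 → |g K x - g K y| ≤ 1 * |x - y|) ∧
        (∀ (K : ℕ) (x : ℝ), x ∈ Set.Icc (-1 : ℝ) 1 → |g K x| ≤ 1) ∧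
        ¬ Summable (fun K => |∫ x, g K x ∂Λ (K + 1) - ∫ x, g K x ∂Λ K|) :=
  exists_target_not_summable_lawIncrements_of_pos hl₀ hvol (fun K => lt_of_lt_of_le (by positivity) (hle K)) hsum
    (not_summable_logRate_of_geometric_le hvol hC hθ hle)

end Summit.QuantumFields.YangMills.Theorems.BalabanUVNodesN19LawSummabilityThresholdExact

end
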